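import Summits.QuantumFields.YangMills.Theorems.BalabanUVNodesN15PerCubeGreenTwoGridKnitDefectReg335HolderRate
import HarnessLib

/-!
# N15 = NE2, road (c) — PROGRAMME (PC), (PC-E-H) IN THE NODE's READOUT CURRENCY: THE TWO-GRID η-DEFECT OF THE GLUED SCALAR COVARIANT GREEN's FUNCTIONS ON THE PRINTED PER-CUBE CLASS
# AS THE `n = 0` ROW OF n15-b's `OperatorReadout.etaRateIneq342_of_hasMaj_rateWeight` — `c₀·e^{−δ₀d(y,y′)}·w_γ(y′)` with `T4EtaRateDefect.rateWeight` at ANY `0 < γ ≤ min(1∕4, β₀)`, between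
# dag-n15-w3's sharp block norms, constants uniform in the fine spacing (dag-n15-c g34, n15-c∕375)

Cell `pub-ymgap`, seat `pub-ymgap-dag-n15-c` (generation g34; R134 (a) seat, strategy s1 «first missing estimate»; HUMAN RULING D-0062; chair R424 venue).
`bears_on: R4∕N15 · K3⁸ SpineGivenEndpointR13SepCoPHV (stmt-QuantumFields-27366)`; filed `--kind proof --supports stmt-QuantumFields-27366 --as helper` — COUNT-NEUTRAL.
ONE theorem, 0 `def`, 0 `sorry`: ★★★ `hasMaj_idef_scGreen_entryZero_rateWeight_of_reg910` = n15-c∕374 `uN_idef_scGreen_tr_of_reg910_rate` with its rate factor `L^{−k∕4} + (2L^{−k})^{β₀}`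
dominated by `(1 + 2^{β₀})·w_γ(y′)`, `w_γ(y′) = T4EtaRateDefect.rateWeight (unitTorusGeo L k (cvM …)) γ y′ = (L^k)^{−γ}` (the unit-torus block geometry has constant scale `k`), for every
`0 < γ ≤ min(1∕4, β₀)` (`(L^k)^{−1∕4} ≤ (L^k)^{−γ}`, `(2L^{−k})^{β₀} = 2^{β₀}(L^k)^{−β₀} ≤ 2^{β₀}(L^k)^{−γ}`, `L^k ≥ 1`).  The source norm `ScNorm` IS `BlockNorm.ofBlocks (unitTorusGeo …)
(liftBlk scBlk ι)` (dag-n15-w3, `rfl`) and the target is `BlockNorm.ofBlocks (unitTorusGeo …) (liftBlk (scBlk ∘ kingPr) ι)`, so the conclusion is LITERALLY the `n = 0` input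
`HasMaj (BlockNorm.ofBlocks g blk) (BlockNorm.ofBlocks g blk′) (T 0 U) (fun y y′ => c 0 * Real.exp (−(δ₀ * g.dist y y′)) * rateWeight g γ y′)` of n15-b's producer
`OperatorReadout.etaRateIneq342_of_hasMaj_rateWeight` (`X := ScX × ι`, `X′ := ScX′ × ι`, `δ₀ := δ∕16`, `T 0 U′ :=` the two-grid η-defect operator of the glued scalar covariant Green's
functions in the produced cube gauges) — the ENTRY-0 socket of `T4EtaRate.EtaRateIneq342` ∕ `NE2PlusOperator` for `G′(U)` ([B9] Thm 3.1 is about `G′`) in the MODEL two-grid setting of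
record.  Imports BY NAME n15-c∕374 (through it `T4EtaRateDefect.rateWeight`); nothing in the tree is modified, no landed name re-declared.

WHAT IS NOT HERE (LOCATED, not claimed).  Entries `n = 1, 2, 3` of (3.42) (`∇_UG′`, `G′∇*_U`, `Δ_UG′`): their two-grid η-defects in the per-cube-gauge ∕ covariant-transport setting are the JET
editions of the (PC-E) glue (HOME `PCE-DESIGN-g31.md` §6: «entries 1–3 follow the same way with 278∕329's jets»); with them n15-b's producer gives `EtaRateIneq342` and
`OperatorReadout.ne2PlusOperator_of_hasMaj` gives `T4EtaRate.NE2PlusOperator` BY NAME for the realised instance family of the scalar covariant Green's function.  Not typed tonight.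

HONEST FRAMING ∕ LIMITS.  Bookkeeping (real powers); the datum is dag-n07-a's typed `Reg910Cube` ([Balaban1985Variational] Thm 1 (9)–(10) per cube AS TYPED) as a HYPOTHESIS (production = node
N04∕N07, NOT claimed); MODEL two-grid setting (King tori, straight-holonomy pairing, one cube scale); nothing of [B9]∕[B11] asserted.  NE2⁺ NOT PRINTED ∕ NOT proved; N15 of record untouched
(DISCHARGED AS CONSUMED, p687738); K3⁸ OPEN; counts of record UNMOVED (typed 28∕28 · discharged 8∕27); one finite 𝕋⁴ at fixed ε per index — NOT infinite volume, NOT OS on ℝ⁴, NOT a mass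
gap, NOT Clay.  Restate-immune (no Theses import).
-/

set_option autoImplicit false

noncomputable section

open scoped BigOperators Matrix Matrix.Norms.L2Operator
open Finset

namespace Summit.QuantumFields.YangMills.BalabanUVNodes.N15.Gluing

open Real
open Literature.MathematicalPhysics.QuantumFieldTheory.Balaban1983to89
open Literature.MathematicalPhysics.QuantumFieldTheory.Balaban1983to89.B5Prop11Plancherel (Tor fine unitVec)
open Literature.MathematicalPhysics.QuantumFieldTheory.Balaban1983to89.B11SectG (BlockNorm HasMaj)
open Literature.MathematicalPhysics.QuantumFieldTheory.Balaban1983to89.T4EtaRateDefect (idef rateWeight)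
open Literature.MathematicalPhysics.QuantumFieldTheory.Balaban1983to89.B6UnitTorusCarrier (unitTorusGeo)
open Literature.MathematicalPhysics.QuantumFieldTheory.King1986 (aK)
open Literature.MathematicalPhysics.QuantumFieldTheory.King1986.Torus (tdistT)
open Literature.Barriers.QuantumFields (traceForm)
open Summit.QuantumFields.YangMills.BalabanUVNodes.N15.VectorPiece (kingPr)
open Summit.QuantumFields.YangMills.BalabanUVNodes.N15.MatrixSpecies (coordMat basisConst basisConst_nonneg liftBlk liftMap)
open Summit.QuantumFields.YangMills.BalabanUVNodes.N15.CovAvg (mprod kingSec ctauS)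

variable {d : ℕ} {L : ℕ} [NeZero L]

set_option maxHeartbeats 800000 in
/-- ★★★ **THE (PC-E-H) RATE AS THE `n = 0` ROW OF THE NODE's OPERATOR-LAYER READOUT** — see the module docstring. [cite: Balaban1985BackgroundPropagators, Thm 3.1 (3.42) p.397 (entry 0:
shape), (3.35) p.396, (3.40) p.397; Balaban1985Variational, Thm 1 (9)–(10) p.279; King1986, Prop. 3.9 (3.73) p.665 (rate factor), Lemma 4.5 (4.38) p.674 (A = 0 template)] -/
theorem hasMaj_idef_scGreen_entryZero_rateWeight_of_reg910 (hL : Odd L ∧ 1 < L) (hL7 : 7 ≤ L) {a₀ : ℝ} (ha₀ : 0 < a₀) (ι : Type) [Fintype ι] [DecidableEq ι] :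
    ∃ δ w₀ c₀ D : ℝ, 0 < δ ∧ 0 < c₀ ∧ 0 ≤ D ∧ ∀ (mv kk r : ℕ), 1 ≤ kk → 1 ≤ r → w₀ ≤ ((L ^ mv : ℕ) : ℝ) →
      ∀ {mm : Type} [Fintype mm] [DecidableEq mm] [Nonempty mm] (e : Matrix mm mm ℂ ≃L[ℝ] (ι → ℝ)), (∀ A B : Matrix mm mm ℂ, traceForm A B = e A ⬝ᵥ e B) →
      ∀ (U' : Fin (d + 1) → ScX' d L mv kk r hL → (Matrix mm mm ℂ)ˣ), (∀ μ x', (U' μ x' : Matrix mm mm ℂ) ∈ Matrix.unitaryGroup mm ℂ) →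
      ∀ (Q : (Fin (d + 1) → ZMod (2 * L)) → Set (ScX' d L mv kk r hL)) (ξ C β₀ C₄ γ : ℝ), 0 < ξ → 0 ≤ C → 0 ≤ β₀ → 0 ≤ C₄ →
        -- the rate exponent of the readout: any `0 < γ ≤ min(1∕4, β₀)`
        0 < γ → γ ≤ 1 / 4 → γ ≤ β₀ →
        (1 + @basisConst ι _ (Matrix mm mm ℂ) Matrix.frobeniusNormedAddCommGroup Matrix.frobeniusNormedSpace e * (2 * Real.sqrt (Fintype.card mm)) * Real.sqrt (Fintype.card mm)) ^ 2 * (C / ξ + C / ξ ^ 2) ≤ c₀ →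
        -- [B11] Thm 1 (9)–(10) per cube AS TYPED (dag-n07-a), η′-scale fine torus distance
        (∀ k, B11Reg910Classes.Reg910Cube (scShift' d L mv kk r hL) U' ((((L ^ r * L ^ kk : ℕ) : ℝ))⁻¹) (Q k) ξ (fun z z' => ((((L ^ r * L ^ kk : ℕ) : ℝ))⁻¹) * tdistT (fine (L ^ r * L ^ kk) (cvM d L mv kk hL)) z z') C C₄ β₀) →
        (∀ k z, (∃ y ∈ cvSk d L mv kk hL k, (unitTorusGeo L kk (cvM d L mv kk hL)).dist (scBlk' d L mv kk r hL z) y ≤ 5) → z ∈ Q k) →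
      ∃ u' : (Fin (d + 1) → ZMod (2 * L)) → ScX' d L mv kk r hL → Matrix mm mm ℂ, (∀ k x', (u' k x')ᴴ * u' k x' = 1) ∧
       (
        HasMaj (ScNorm d L mv kk hL ι) (BlockNorm.ofBlocks (unitTorusGeo L kk (cvM d L mv kk hL)) (liftBlk (scBlk d L mv kk hL ∘ kingPr L kk r (cvM d L mv kk hL)) ι))
          (idef (ctauS (cvM d L mv kk hL) L kk r (fun μ x' => coordMat e (ContinuousLinearMap.mulLeftRight ℝ (Matrix mm mm ℂ) ((U' μ x' : Matrix mm mm ℂ)) ((U' μ x' : Matrix mm mm ℂ))ᴴ))) (ctauS (cvM d L mv kk hL) L kk r (fun μ x' => coordMat e (ContinuousLinearMap.mulLeftRight ℝ (Matrix mm mm ℂ) ((U' μ x' : Matrix mm mm ℂ)) ((U' μ x' : Matrix mm mm ℂ))ᴴ))) (scGlued' d L mv kk r hL (aK a₀ (L : ℝ) (r + kk) * (((L ^ r * L ^ kk : ℕ) : ℝ)) ^ (d + 1)) ((((L ^ r * L ^ kk : ℕ) : ℝ))⁻¹) ι e u' (fun μ z => (U' μ z : Matrix mm mm ℂ)) (scP'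 d L mv kk r hL (aK a₀ (L : ℝ) (r + kk) * (((L ^ r * L ^ kk : ℕ) : ℝ)) ^ (d + 1)) ι e (fun μ z => (U' μ z : Matrix mm mm ℂ))) (scNV' d L mv kk r hL (aK a₀ (L : ℝ) (r + kk) * (((L ^ r * L ^ kk : ℕ) : ℝ)) ^ (d + 1)) ι e u' (fun μ z => (U' μ z : Matrix mm mm ℂ)))) (scGlued d L mv kk hL (aK a₀ (L : ℝ) kk * (((L ^ kk : ℕ) : ℝ)) ^ (d + 1)) ((((L ^ kk : ℕ) : ℝ))⁻¹) ι e (fun k x => u' k (kingSec (cvM d L mv kk hL) L kk r x)) (fun μ y => mprod (fun t => (U' μ (kingSec (cvM d L mv kk hL) L kk r y + t • unitVec (fine (L ^ r * L ^ kk) (cvM d L mv kk hL)) μ) : Matrix mm mm ℂ)) (L ^ r)) (scP d L mv kk hL (aK a₀ (L : ℝ) kk * (((L ^ kk : ℕ) : ℝ)) ^ (d + 1)) ι e (fun μ y => mprod (fun t => (U' μ (kingSec (cvM d L mv kk hL) L kk r y + t • unitVec (fine (L ^ r * L ^ kk) (cvM d L mv kk hL)) μ) : Matrix mm mm ℂ))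 (L ^ r))) (scNV d L mv kk hL (aK a₀ (L : ℝ) kk * (((L ^ kk : ℕ) : ℝ)) ^ (d + 1)) ι e (fun k x => u' k (kingSec (cvM d L mv kk hL) L kk r x)) (fun μ y => mprod (fun t => (U' μ (kingSec (cvM d L mv kk hL) L kk r y + t • unitVec (fine (L ^ r * L ^ kk) (cvM d L mv kk hL)) μ) : Matrix mm mm ℂ)) (L ^ r)))))
          -- EXACTLY the `n = 0` hypothesis `h 0` of n15-b's `OperatorReadout.etaRateIneq342_of_hasMaj_rateWeight` (`blk := liftBlk scBlk ι`, `blk′ := liftBlk (scBlk ∘ kingPr) ι`, `δ₀ := δ∕16`)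
          (fun y y' => D * (1 + @basisConst ι _ (Matrix mm mm ℂ) Matrix.frobeniusNormedAddCommGroup Matrix.frobeniusNormedSpace e * Fintype.card mm * ((4 * C₄ * (ξ ^ (2 + β₀))⁻¹ * Real.exp (5 * (C / ξ))) + ((2 * ((d + 1 : ℕ) : ℝ) + 2) * ((C / ξ ^ 2) ^ 2 * Real.exp (2 * (C / ξ))) + 8 * ((C / ξ) * (C / ξ ^ 2) * Real.exp (2 * (C / ξ))) + 8 * ((C / ξ) * (C / ξ ^ 2) * Real.exp (5 * (C / ξ)))))) * (1 + (2 : ℝ) ^ β₀) * Real.exp (-(δ / 16 * (unitTorusGeo L kk (cvM d L mv kk hL)).dist y y')) * rateWeight (unitTorusGeo L kk (cvM d L mv kk hL)) γ y')) := by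
  obtain ⟨δ, w₀, c₀, D, hδ, hc₀, hD, H⟩ := uN_idef_scGreen_tr_of_reg910_rate (d := d) hL hL7 ha₀ ι
  have hL1r : (1 : ℝ) < (L : ℝ) := by exact_mod_cast hL.2
  refine ⟨δ, w₀, c₀, D, hδ, hc₀, hD, fun mv kk r hk hr hw₀ => ?_⟩
  intro mm _ _ _ e he U' hU'g Q ξ C β₀ C₄ γ hξ hC hβ₀ hC₄ hγ hγ4 hγβ hsmall h910 hQ
  obtain ⟨u', hu', hmain⟩ := H mv kk r hk hr hw₀ e he U' hU'g Q ξ C β₀ C₄ hξ hC hβ₀ hC₄ hsmall h910 hQ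
  refine ⟨u', hu', hmain.mono fun y y' => ?_⟩
  have hκ := @basisConst_nonneg ι _ (Matrix mm mm ℂ) Matrix.frobeniusNormedAddCommGroup Matrix.frobeniusNormedSpace e
  have hx1 : (1 : ℝ) ≤ (L : ℝ) ^ kk := one_le_pow₀ hL1r.le
  have hx0 : (0 : ℝ) < (L : ℝ) ^ kk := by positivity
  -- the readout weight on the unit-torus block geometry: `w_γ(y′) = (L^k)^{−γ}`
  have hw : rateWeight (unitTorusGeo L kk (cvM d L mv kk hL)) γ y' = ((L : ℝ) ^ kk) ^ (-γ) := rfl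
  rw [hw]
  -- `(L^k)^{−1∕4} ≤ (L^k)^{−γ}` and `(2L^{−k})^{β₀} ≤ 2^{β₀}(L^k)^{−γ}`
  have h14 : ((L : ℝ) ^ kk) ^ (-(1 / 4 : ℝ)) ≤ ((L : ℝ) ^ kk) ^ (-γ) := Real.rpow_le_rpow_of_exponent_le hx1 (by linarith)
  have hηeq : ((((L ^ kk : ℕ) : ℝ))⁻¹) = ((L : ℝ) ^ kk)⁻¹ := by rw [Nat.cast_pow]
  have hβ' : (2 * ((((L ^ kk : ℕ) : ℝ))⁻¹)) ^ β₀ ≤ (2 : ℝ) ^ β₀ * ((L : ℝ) ^ kk) ^ (-γ) := by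
    rw [hηeq, Real.mul_rpow (by norm_num) (inv_nonneg.mpr hx0.le), Real.inv_rpow hx0.le, ← Real.rpow_neg hx0.le]
    exact mul_le_mul_of_nonneg_left (Real.rpow_le_rpow_of_exponent_le hx1 (by linarith)) (Real.rpow_nonneg (by norm_num) _)
  have hwγ0 : (0 : ℝ) ≤ ((L : ℝ) ^ kk) ^ (-γ) := Real.rpow_nonneg hx0.le _
  have hsum : ((L : ℝ) ^ kk) ^ (-(1 / 4 : ℝ)) + (2 * ((((L ^ kk : ℕ) : ℝ))⁻¹)) ^ β₀ ≤ (1 + (2 : ℝ) ^ β₀) * ((L : ℝ) ^ kk) ^ (-γ) := by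
    have := add_le_add h14 hβ'; linarith
  have hR0 : (0 : ℝ) ≤ 1 + @basisConst ι _ (Matrix mm mm ℂ) Matrix.frobeniusNormedAddCommGroup Matrix.frobeniusNormedSpace e * Fintype.card mm * ((4 * C₄ * (ξ ^ (2 + β₀))⁻¹ * Real.exp (5 * (C / ξ))) + ((2 * ((d + 1 : ℕ) : ℝ) + 2) * ((C / ξ ^ 2) ^ 2 * Real.exp (2 * (C / ξ))) + 8 * ((C / ξ) * (C / ξ ^ 2) * Real.exp (2 * (C / ξ))) + 8 * ((C / ξ) * (C / ξ ^ 2) * Real.exp (5 * (C / ξ))))) := by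
    have : (0 : ℝ) < ξ ^ (2 + β₀) := Real.rpow_pos_of_pos hξ _
    positivity
  have hDR : 0 ≤ D * (1 + @basisConst ι _ (Matrix mm mm ℂ) Matrix.frobeniusNormedAddCommGroup Matrix.frobeniusNormedSpace e * Fintype.card mm * ((4 * C₄ * (ξ ^ (2 + β₀))⁻¹ * Real.exp (5 * (C / ξ))) + ((2 * ((d + 1 : ℕ) : ℝ) + 2) * ((C / ξ ^ 2) ^ 2 * Real.exp (2 * (C / ξ))) + 8 * ((C / ξ) * (C / ξ ^ 2) * Real.exp (2 * (C / ξ))) + 8 * ((C / ξ) * (C / ξ ^ 2) * Real.exp (5 * (C / ξ)))))) := mul_nonneg hD hR0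
  calc D * (1 + @basisConst ι _ (Matrix mm mm ℂ) Matrix.frobeniusNormedAddCommGroup Matrix.frobeniusNormedSpace e * Fintype.card mm * ((4 * C₄ * (ξ ^ (2 + β₀))⁻¹ * Real.exp (5 * (C / ξ))) + ((2 * ((d + 1 : ℕ) : ℝ) + 2) * ((C / ξ ^ 2) ^ 2 * Real.exp (2 * (C / ξ))) + 8 * ((C / ξ) * (C / ξ ^ 2) * Real.exp (2 * (C / ξ))) + 8 * ((C / ξ) * (C / ξ ^ 2) * Real.exp (5 * (C / ξ)))))) * (((L : ℝ) ^ kk) ^ (-(1 / 4 : ℝ)) + (2 * ((((L ^ kk : ℕ) : ℝ))⁻¹)) ^ β₀) * Real.exp (-(δ / 16 * (unitTorusGeo L kk (cvM d L mv kk hL)).dist y y'))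
      ≤ D * (1 + @basisConst ι _ (Matrix mm mm ℂ) Matrix.frobeniusNormedAddCommGroup Matrix.frobeniusNormedSpace e * Fintype.card mm * ((4 * C₄ * (ξ ^ (2 + β₀))⁻¹ * Real.exp (5 * (C / ξ))) + ((2 * ((d + 1 : ℕ) : ℝ) + 2) * ((C / ξ ^ 2) ^ 2 * Real.exp (2 * (C / ξ))) + 8 * ((C / ξ) * (C / ξ ^ 2) * Real.exp (2 * (C / ξ))) + 8 * ((C / ξ) * (C / ξ ^ 2) * Real.exp (5 * (C / ξ)))))) * ((1 + (2 : ℝ) ^ β₀) * ((L : ℝ) ^ kk) ^ (-γ)) * Real.exp (-(δ / 16 * (unitTorusGeo L kk (cvM d L mv kk hL)).dist y y')) :=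
        mul_le_mul_of_nonneg_right (mul_le_mul_of_nonneg_left hsum hDR) (Real.exp_pos _).le
    _ = D * (1 + @basisConst ι _ (Matrix mm mm ℂ) Matrix.frobeniusNormedAddCommGroup Matrix.frobeniusNormedSpace e * Fintype.card mm * ((4 * C₄ * (ξ ^ (2 + β₀))⁻¹ * Real.exp (5 * (C / ξ))) + ((2 * ((d + 1 : ℕ) : ℝ) + 2) * ((C / ξ ^ 2) ^ 2 * Real.exp (2 * (C / ξ))) + 8 * ((C / ξ) * (C / ξ ^ 2) * Real.exp (2 * (C / ξ))) + 8 * ((C / ξ) * (C / ξ ^ 2) * Real.exp (5 * (C / ξ)))))) * (1 + (2 : ℝ) ^ β₀) * Real.exp (-(δ / 16 * (unitTorusGeo L kk (cvM d L mv kk hL)).dist y y')) * ((L : ℝ) ^ kk) ^ (-γ) := by ring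

end Summit.QuantumFields.YangMills.BalabanUVNodes.N15.Gluing

end
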